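/- CRUX WORKFILE (tm-g4 g5, 2026-08-28): v3 growth checker VARIANT C — interval chunk transfers. Five modules concatenated for reading/elaboration: …CertificateFormatVGrowthC (defs) · …GrowthCRun · …GrowthCPairs · …GrowthCSound · …CertificateCloserVC. rc 0, 0 sorry, closer axioms = {propext, Classical.choice, Quot.sound}. Not yet proposed to the tree (lands on cert-1 LAMFAC-by-span numbers). MODEL rung TL-M3 only. -/
import HarnessLib
import Mathlib
import Summits.NavierStokesRegularity.NavierStokesRegularity.Theorems.TaylorModelRungThreeCertificateCloserV
import Summits.NavierStokesRegularity.NavierStokesRegularity.Theorems.TaylorModelRungThreeCertificateFormatVGrowth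
import Summits.NavierStokesRegularity.NavierStokesRegularity.Theorems.TaylorModelRungThreeCertificateFormatVGrowthPairs
import Summits.NavierStokesRegularity.NavierStokesRegularity.Theorems.TaylorModelRungThreeCertificateFormatVGrowthRun
import Summits.NavierStokesRegularity.NavierStokesRegularity.Theorems.TaylorModelRungThreeCertificateFormatVGrowthSound

-- ===== work/GrowthC.lean =====

/-!
# Crux K1b-DR (stmt-NavierStokesRegularity-23954), line `taylor-model` — v3 certificate: tube-growth checker, VARIANT C
# (cross-chunk transfer by INTERVAL matrices; tm-g4 g5)

Variant of `…CertificateFormatVGrowth` (v1) that changes ONLY the cross-chunk transport. In v1 the start vector `ũ_a` of an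
earlier chunk is carried across every intermediate chunk boundary by the emitted MAGNITUDE matrices `T̃_q` (`wVec`), so all sign
cancellation between chunks is lost (one split per boundary). Here the emitted chunk transfer is an INTERVAL matrix
`T_q ⊇ [M_{(q+1)L−1}]⋯[M_{qL}]` (claim tested by `subsetIM` at the end of chunk `q`'s run), the transfers of the intermediate
chunks are multiplied FIRST as interval matrices (`RS`, `q − 2` extra `n³` products per chunk file, shared by all starts) and the
magnitude is taken once: `W[a'] = (|T_{q−1}⋯T_{a'/L+1}| · ũ_{a'})↑` — two splits (after `a'`'s chunk, before `b`'s chunk)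
whatever the span. In-chunk work, tests, `gL1`, `ũ`, (R0)/(R1)/(R3b) are v1's VERBATIM (`GCtx.step/pairTest/facOf`, `checkL1`,
`checkR0`, `checkR1` are reused, not copied).

* DATA (`stageV j .landAux`): `landAux[0][0] = gL1`, `landAux[1][a] = ũ_a` (as v1: `ũ_a ≥ (|[M_{C−1}]⋯[M_a]|·ω_j↑)↑`, `C` the next
  chunk boundary after `a`), and per chunk `q` with a later chunk the PAIR `landAux[2+2q] = Tlo_q`, `landAux[3+2q] = Thi_q`
  (row-major `n×n` dyadics) with `[Tlo_q, Thi_q] ⊇ [M_{(q+1)L−1}]⋯[M_{qL}]` entrywise (`gTI`).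
* `RS j q m` — the interval product `T_{q−1}·T_{q−2}⋯T_{q−m}` (`m = 0`: identity); `RSarr` computes `RS j q 0, …, RS j q k` with one
  product each; `wVecC j L q a' = (|RS j q (q − 1 − a'/L)| · ũ_{a'})↑`.
* `gctxC j L q : GCtx` — v1's context with `W[a'] := wVecC …` (and `Tq := #[]`, unused); `GCtx.claimsOKC` — the chunk-end claims
  with the interval test; `growthRunC` / `growthRangeC P j L q` — v1's run with these two changes; `gDC` / `GrC` — THE TABLE `G`
  of this variant (in-chunk pairs as v1, cross-chunk pairs with `wVecC`).

Definitions only; soundness in `…FormatVGrowthCSound`. Cost per chunk as v1 plus `max(q−2, 0)` interval products. MODEL-lattice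
bookkeeping only (rung TL-M3); nothing here is a statement about the Navier–Stokes equations, and nothing is asserted.
-/

-- the sub-problem namespace repeats the summit name by design (D-0017)
set_option linter.dupNamespace false

namespace Summit.NavierStokesRegularity.NavierStokesRegularity.Theorems.TaylorModelCert

open scoped BigOperators

namespace GCtx

variable (G : GCtx)

/-- **Chunk-end claims, variant C** (only if a later chunk exists, `s < S` at the chunk end `s`): the chunk product
`P(s ← qL) ⊆ T_q` entrywise (interval test) and `(|P(s ← a)|·ω↑)↑ ≤ ũ_a` for every start `a` of the chunk. [folklore] -/
def claimsOKC (TI : Array (Array IntervalD)) (s : ℕ) (pre : Array (Array (Array IntervalD))) : Bool :=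
  decide (G.S ≤ s) ||
    (subsetIM G.n (pre.getD 0 #[]) TI &&
      allN pre.size fun i => leVec G.n (absMulVecUp G.n G.prec (magM G.n (pre.getD i #[])) G.ωhi) (G.U (G.q * G.L + i)))

end GCtx

namespace CertTablesV

variable (TV : CertTablesV) (kitOf : ℕ → CoreKit) (wT : ℕ → Array Dyad)

/-! ### Emitted interval transfer matrices -/

/-- Lower ends of the emitted transfer matrix `T_q` of chunk `q` (`landAux[2+2q]`, row-major `n×n` dyadics). [folklore] -/
def gTlo (j q : ℕ) : Array (Array Dyad) := (TV.stageV j).landAux.getD (2 + 2 * q) #[]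

/-- Upper ends of the emitted transfer matrix `T_q` of chunk `q` (`landAux[3+2q]`). [folklore] -/
def gThi (j q : ℕ) : Array (Array Dyad) := (TV.stageV j).landAux.getD (3 + 2 * q) #[]

/-- **The emitted interval transfer matrix `T_q = [Tlo_q, Thi_q]`** of chunk `q` (claimed `⊇ [M_{(q+1)L−1}]⋯[M_{qL}]`). [folklore] -/
def gTI (j q : ℕ) : Array (Array IntervalD) :=
  Array.ofFn (n := TV.base.n) fun r => Array.ofFn (n := TV.base.n) fun c => ⟨dmget (TV.gTlo j q) r c, dmget (TV.gThi j q) r c⟩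

/-- **`RS j q m := T_{q−1}·T_{q−2}⋯T_{q−m}`** (interval products, bracketed from the left; `m = 0`: identity) — encloses the transfer
`P(C_q ← C_{q−m})` of the `m` chunks before chunk `q`. [folklore] -/
def RS (j q : ℕ) : ℕ → Array (Array IntervalD)
  | 0 => idIM TV.base.n
  | m + 1 => mulII TV.base.n TV.prec (RS j q m) (TV.gTI j (q - 1 - m))

/-- `RSarr j q k = #[RS j q 0, …, RS j q k]`, computed with ONE product per entry. [folklore] -/
def RSarr (j q : ℕ) : ℕ → Array (Array (Array IntervalD))
  | 0 => #[idIM TV.base.n]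
  | k + 1 =>
    let A := RSarr j q k
    A.push (mulII TV.base.n TV.prec (A.getD k #[]) (TV.gTI j (q - 1 - k)))

/-- **The transported start vector, variant C**: `(|RS j q (q − 1 − a'/L)| · ũ_{a'})↑` (for the chunk right after `a'`'s chunk the
matrix is the identity). [folklore] -/
def wVecC (j L q a' : ℕ) : Array Dyad :=
  absMulVecUp TV.base.n TV.prec (magM TV.base.n (TV.RS j q (q - 1 - a' / L))) (TV.gU j a')

/-- **The growth context of chunk `q` of stage `j`, variant C**: v1's `gctx` with the transported start vectors `W[a'] = wVecC a'`,
the magnitude matrices `|RS j q m|` computed once from `RSarr`. (`Tq` is not used by this variant.) [folklore] -/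
def gctxC (j L q : ℕ) : GCtx :=
  let mags : Array (Array (Array Dyad)) := (TV.RSarr j q (q - 1)).map (magM TV.base.n)
  { n := TV.base.n, prec := TV.prec, L := L, q := q, S := TV.S j, gL1 := TV.gL1 j, ωhi := TV.ωhiV j, ωinvhi := TV.ωinvhiV j,
    ΛdesLo := (IntervalD.ofQS2 TV.prec (TV.stageV j).Λdes).lo, ΛLo := (IntervalD.ofQS2 TV.prec (TV.base.stage j).Λ).lo,
    W := Array.ofFn (n := q * L) fun a' =>
      absMulVecUp TV.base.n TV.prec (mags.getD (q - 1 - a' / L) #[]) (TV.gU j a'),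
    U := TV.gU j, Tq := #[] }

/-! ### The table `G` of variant C -/

/-- **THE GROWTH TABLE `G_j(a,b)`, variant C** (`a ≤ b ≤ S`): in-chunk pairs as v1 (direct interval product), cross-chunk pairs by
the split at the start `C_{q_b}` of `b`'s chunk with the transported start vector `wVecC`. [folklore] -/
def gDC (j L a b : ℕ) : Dyad :=
  if b ≤ (a / L + 1) * L then (TV.gctx j L (a / L)).facOf (TV.prodM kitOf wT j a (b - a)) (TV.ωhiV j)
  else (TV.gctx j L ((b - 1) / L)).facOf (TV.prodM kitOf wT j ((b - 1) / L * L) (b - (b - 1) / L * L))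
    (TV.wVecC j L ((b - 1) / L) a)

/-- The real table `G` (variant C) handed to `ReadoutsV`. [folklore] -/
noncomputable def GrC (j L a b : ℕ) : ℝ := (TV.gDC kitOf wT j L a b).toReal

/-! ### The chunk run, variant C -/

/-- **THE CHUNK RUN, variant C**: v1's `growthRun` with the context `G` (meant: `gctxC j L q`) and the interval chunk claim
`claimsOKC (gTI j q)` at the end. [folklore] -/
def growthRunC (P : ℕ → CoreOut → Bool) (j : ℕ) (G : GCtx) (TI : Array (Array IntervalD)) :
    ℕ → ℕ → NodeSt → Array (Array (Array IntervalD)) → Bool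
  | 0, s, _, pre => G.claimsOKC TI s pre
  | k + 1, s, N, pre =>
    let o := (TV.ctxOfW kitOf wT j).subStep s N
    let r := G.step s o.core.M o.core.L1 pre
    ((o.ok && P s o.core) && r.2) && growthRunC P j G TI k (s + 1) o.next r.1

/-- **GROWTH CHUNK CHECK, variant C** of chunk `q` of stage `j` (chunk length `L`): the run over `[qL, min((q+1)L, S))` from the
chunk's start state `startNode (qL)`. [folklore] -/
def growthRangeC (P : ℕ → CoreOut → Bool) (j L q : ℕ) : Bool :=
  TV.growthRunC kitOf wT P j (TV.gctxC j L q) (TV.gTI j q) (min L (TV.S j - q * L)) (q * L)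
    ((TV.ctxOfW kitOf wT j).startNode (q * L)) #[]

end CertTablesV

end Summit.NavierStokesRegularity.NavierStokesRegularity.Theorems.TaylorModelCert

-- ===== work/GrowthCRun.lean =====

/-!
# Crux K1b-DR (stmt-NavierStokesRegularity-23954), line `taylor-model` — v3 growth checker VARIANT C, SOUNDNESS part 1:
# the chunk run (tm-g4 g5)

For `…CertificateFormatVGrowthC` (interval chunk transfers): field reductions of `gctxC`, `facOf_gctxC` (the factor map is v1's),
`RSarr_getD` (the shared products are the `RS`), `W_gctxC` (the context's transported start vectors ARE `wVecC`), and — verbatim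
along v1's `growthRun_sound` (same `GCtx.step`, same product invariant `pre_invariant`) — **`growthRunC_sound`**,
**`growthRangeC_sound`**, **`claimsC_sound`**: a `true` chunk run certifies, for every sub-step of the chunk, the chain Boolean, the
caller's predicate, `0 ≤ L1_s ≤ gL1[s]`, the pair tests of all pairs `(a', s+1)` with the factors of the TRUE products `prodM`
(split factors with `wVecC` for earlier chunks), and at the chunk end the interval claim `prodM (qL) L ⊆ T_q` and the start-vector
claims `ũ`. MODEL-lattice bookkeeping only (rung TL-M3); nothing here is a statement about the Navier–Stokes equations.
-/

-- the sub-problem namespace repeats the summit name by design (D-0017)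
set_option linter.dupNamespace false

namespace Summit.NavierStokesRegularity.NavierStokesRegularity.Theorems.TaylorModelCert

open scoped BigOperators

namespace CertTablesV

variable {TV : CertTablesV} {kitOf : ℕ → CoreKit} {wT : ℕ → Array Dyad} {sc : ScalarsV}

/-! ### Field reductions -/

/-- [folklore] -/ theorem gctxC_n (j L q : ℕ) : (TV.gctxC j L q).n = TV.base.n := rfl
/-- [folklore] -/ theorem gctxC_prec (j L q : ℕ) : (TV.gctxC j L q).prec = TV.prec := rfl
/-- [folklore] -/ theorem gctxC_ωinvhi (j L q : ℕ) : (TV.gctxC j L q).ωinvhi = TV.ωinvhiV j := rfl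
/-- [folklore] -/ theorem gctxC_ωhi (j L q : ℕ) : (TV.gctxC j L q).ωhi = TV.ωhiV j := rfl
/-- [folklore] -/ theorem gctxC_q (j L q : ℕ) : (TV.gctxC j L q).q = q := rfl
/-- [folklore] -/ theorem gctxC_L (j L q : ℕ) : (TV.gctxC j L q).L = L := rfl
/-- [folklore] -/ theorem gctxC_gL1 (j L q : ℕ) : (TV.gctxC j L q).gL1 = TV.gL1 j := rfl
/-- [folklore] -/ theorem gctxC_S (j L q : ℕ) : (TV.gctxC j L q).S = TV.S j := rfl
/-- [folklore] -/ theorem gctxC_U (j L q : ℕ) : (TV.gctxC j L q).U = TV.gU j := rfl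
/-- [folklore] -/ theorem gctxC_ΛdesLo (j L q : ℕ) :
    (TV.gctxC j L q).ΛdesLo = (IntervalD.ofQS2 TV.prec (TV.stageV j).Λdes).lo := rfl
/-- [folklore] -/ theorem gctxC_ΛLo (j L q : ℕ) :
    (TV.gctxC j L q).ΛLo = (IntervalD.ofQS2 TV.prec (TV.base.stage j).Λ).lo := rfl

/-- The factor map of the variant-C context is v1's. [folklore] -/
theorem facOf_gctxC (j L q q' : ℕ) (P : Array (Array IntervalD)) (w : Array Dyad) :
    (TV.gctxC j L q).facOf P w = (TV.gctx j L q').facOf P w := rfl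

/-- The pair test of the variant-C context is v1's. [folklore] -/
theorem pairTest_gctxC (j L q a' b : ℕ) (fac : Dyad) :
    (TV.gctxC j L q).pairTest a' b fac = (TV.gctx j L q).pairTest a' b fac := rfl

/-! ### The shared products `RSarr` are the `RS` -/

/-- `RSarr j q k` has `k + 1` entries. [folklore] -/
theorem size_RSarr (j q : ℕ) : ∀ k : ℕ, (TV.RSarr j q k).size = k + 1
  | 0 => rfl
  | k + 1 => by
    show ((TV.RSarr j q k).push _).size = k + 1 + 1
    rw [Array.size_push, size_RSarr j q k]

/-- **`(RSarr j q k)[m] = RS j q m`** for `m ≤ k`. [folklore] -/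
theorem getD_RSarr (j q : ℕ) : ∀ k m : ℕ, m ≤ k → (TV.RSarr j q k).getD m #[] = TV.RS j q m
  | 0, m, hm => by
    obtain rfl : m = 0 := Nat.le_zero.1 hm
    rfl
  | k + 1, m, hm => by
    show ((TV.RSarr j q k).push (mulII TV.base.n TV.prec ((TV.RSarr j q k).getD k #[]) (TV.gTI j (q - 1 - k)))).getD m #[] = _
    rcases Nat.lt_or_ge m (k + 1) with hlt | hge
    · have hsz : m < (TV.RSarr j q k).size := by rw [size_RSarr]; exact hlt
      rw [getD_push_lt _ _ _ hsz]
      exact getD_RSarr j q k m (by omega)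
    · have hm' : m = k + 1 := le_antisymm hm hge
      subst hm'
      have h := getD_push_size (TV.RSarr j q k)
        (mulII TV.base.n TV.prec ((TV.RSarr j q k).getD k #[]) (TV.gTI j (q - 1 - k))) #[]
      rw [size_RSarr] at h
      rw [h, getD_RSarr j q k k le_rfl]
      rfl

/-- **The context's transported start vectors are `wVecC`**: `(gctxC j L q).W[a'] = wVecC j L q a'` for `a' < qL`.
[folklore] -/
theorem W_gctxC {j L q a' : ℕ} (ha' : a' < q * L) :
    (TV.gctxC j L q).W.getD a' #[] = TV.wVecC j L q a' := by
  show (Array.ofFn (n := q * L) fun a' : Fin (q * L) =>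
      absMulVecUp TV.base.n TV.prec (((TV.RSarr j q (q - 1)).map (magM TV.base.n)).getD (q - 1 - a' / L) #[])
        (TV.gU j a')).getD a' #[] = _
  rw [getD_ofFn_lt _ ha']
  have hm : q - 1 - a' / L ≤ q - 1 := Nat.sub_le _ _
  have hlt : q - 1 - a' / L < (TV.RSarr j q (q - 1)).size := by rw [size_RSarr]; exact Nat.lt_succ_of_le hm
  rw [getD_map_of_lt (magM TV.base.n) (TV.RSarr j q (q - 1)) hlt #[] #[], getD_RSarr j q (q - 1) (q - 1 - a' / L) hm]
  rfl

/-! ### Soundness of the chunk run (variant C) -/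

/-- **`growthRunC` from the true node state certifies every sub-step it runs** (v1's `growthRun_sound` with the context
`gctxC` and the interval claims). [folklore] -/
theorem growthRunC_sound (P : ℕ → CoreOut → Bool) (j L q : ℕ) :
    ∀ (k s : ℕ) (pre : Array (Array (Array IntervalD))),
      TV.growthRunC kitOf wT P j (TV.gctxC j L q) (TV.gTI j q) k s ((TV.ctxOfW kitOf wT j).nodeAt s) pre = true →
      q * L ≤ s → pre.size = s - q * L →
      (∀ i < pre.size, pre.getD i #[] = TV.prodM kitOf wT j (q * L + i) (s - (q * L + i))) →
      (∀ i, i < k →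
        ((TV.ctxOfW kitOf wT j).subStep (s + i) ((TV.ctxOfW kitOf wT j).nodeAt (s + i))).ok = true ∧
        P (s + i) ((TV.ctxOfW kitOf wT j).subStep (s + i) ((TV.ctxOfW kitOf wT j).nodeAt (s + i))).core = true ∧
        (Dyad.ble Dyad.zero (TV.coreVW kitOf wT j (s + i)).L1 = true ∧
          Dyad.ble (TV.coreVW kitOf wT j (s + i)).L1 (dget (TV.gL1 j) (s + i)) = true) ∧
        (∀ i', i' < s + i + 1 - q * L → (TV.gctx j L q).pairTest (q * L + i') (s + i + 1)
          ((TV.gctx j L q).facOf (TV.prodM kitOf wT j (q * L + i') (s + i + 1 - (q * L + i'))) (TV.ωhiV j)) = true) ∧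
        (TV.gctx j L q).pairTest (s + i + 1) (s + i + 1) ((TV.gctx j L q).facOf (idIM TV.base.n) (TV.ωhiV j)) = true ∧
        (∀ a' < q * L, (TV.gctx j L q).pairTest a' (s + i + 1)
          ((TV.gctx j L q).facOf (TV.prodM kitOf wT j (q * L) (s + i + 1 - q * L))
            ((TV.gctxC j L q).W.getD a' #[])) = true)) ∧
      ∃ preF : Array (Array (Array IntervalD)), preF.size = s + k - q * L ∧
        (∀ i < preF.size, preF.getD i #[] = TV.prodM kitOf wT j (q * L + i) (s + k - (q * L + i))) ∧
        (TV.gctxC j L q).claimsOKC (TV.gTI j q) (s + k) preF = true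
  | 0, s, pre, h, hs, hsz, hpre => by
    refine ⟨fun i hi => absurd hi (Nat.not_lt_zero i), pre, by simpa using hsz, ?_, ?_⟩
    · simpa using hpre
    · simpa [growthRunC] using h
  | k + 1, s, pre, h, hs, hsz, hpre => by
    simp only [growthRunC, Bool.and_eq_true] at h
    obtain ⟨⟨⟨hok, hP⟩, hstep⟩, hrest⟩ := h
    have hnext : ((TV.ctxOfW kitOf wT j).subStep s ((TV.ctxOfW kitOf wT j).nodeAt s)).next =
        (TV.ctxOfW kitOf wT j).nodeAt (s + 1) := rfl
    have hM : ((TV.ctxOfW kitOf wT j).subStep s ((TV.ctxOfW kitOf wT j).nodeAt s)).core.M = TV.Mk kitOf wT j s := rfl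
    have hL : ((TV.ctxOfW kitOf wT j).subStep s ((TV.ctxOfW kitOf wT j).nodeAt s)).core.L1 = (TV.coreVW kitOf wT j s).L1 := rfl
    rw [hnext, step_fst, hM] at hrest
    rw [step_snd_iff, hM, hL] at hstep
    simp only [gctxC_n, gctxC_prec, gctxC_q, gctxC_L, gctxC_gL1, gctxC_ωhi, pairTest_gctxC, facOf_gctxC j L q q]
      at hrest hstep
    obtain ⟨hL1, hIn, hDiag, hOut⟩ := hstep
    obtain ⟨hsz', hpre'⟩ := pre_invariant (TV := TV) (kitOf := kitOf) (wT := wT) j q L s hs pre hsz hpre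
    have ih := growthRunC_sound P j L q k (s + 1) _ hrest (by omega) hsz' hpre'
    refine ⟨fun i hi => ?_, ?_⟩
    · cases i with
      | zero =>
        simp only [Nat.add_zero]
        refine ⟨hok, hP, hL1, fun i' hi' => ?_, ?_, fun a' ha' => ?_⟩
        · have hi'' : i' < ((pre.map fun P => mulII TV.base.n TV.prec (TV.Mk kitOf wT j s) P).push (TV.Mk kitOf wT j s)).size := by
            rw [hsz']; exact hi'
          have := hIn i' hi''
          rw [hpre' i' hi''] at this
          exact this
        · exact hDiag
        · have h0 : 0 < ((pre.map fun P => mulII TV.base.n TV.prec (TV.Mk kitOf wT j s) P).push (TV.Mk kitOf wT j s)).size := by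
            rw [hsz']; omega
          have := hOut a' ha'
          rw [hpre' 0 h0] at this
          simpa using this
      | succ i =>
        have := ih.1 i (Nat.lt_of_succ_lt_succ hi)
        simpa only [Nat.add_succ, Nat.succ_add, Nat.add_assoc] using this
    · obtain ⟨preF, h1, h2, h3⟩ := ih.2
      refine ⟨preF, by omega, fun i hi => ?_, ?_⟩
      · rw [h2 i hi]; congr 1; omega
      · have e : s + 1 + k = s + (k + 1) := by omega
        rw [e] at h3; exact h3

/-- **Soundness of the variant-C growth chunk check** (from the chunk's start state). [folklore] -/
theorem growthRangeC_sound {P : ℕ → CoreOut → Bool} {j L q : ℕ} (h : TV.growthRangeC kitOf wT P j L q = true) :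
    (∀ i, i < min L (TV.S j - q * L) →
        ((TV.ctxOfW kitOf wT j).subStep (q * L + i) ((TV.ctxOfW kitOf wT j).nodeAt (q * L + i))).ok = true ∧
        P (q * L + i) ((TV.ctxOfW kitOf wT j).subStep (q * L + i) ((TV.ctxOfW kitOf wT j).nodeAt (q * L + i))).core = true ∧
        (Dyad.ble Dyad.zero (TV.coreVW kitOf wT j (q * L + i)).L1 = true ∧
          Dyad.ble (TV.coreVW kitOf wT j (q * L + i)).L1 (dget (TV.gL1 j) (q * L + i)) = true) ∧
        (∀ i', i' < q * L + i + 1 - q * L → (TV.gctx j L q).pairTest (q * L + i') (q * L + i + 1)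
          ((TV.gctx j L q).facOf (TV.prodM kitOf wT j (q * L + i') (q * L + i + 1 - (q * L + i'))) (TV.ωhiV j)) = true) ∧
        (TV.gctx j L q).pairTest (q * L + i + 1) (q * L + i + 1) ((TV.gctx j L q).facOf (idIM TV.base.n) (TV.ωhiV j)) = true ∧
        (∀ a' < q * L, (TV.gctx j L q).pairTest a' (q * L + i + 1)
          ((TV.gctx j L q).facOf (TV.prodM kitOf wT j (q * L) (q * L + i + 1 - q * L))
            ((TV.gctxC j L q).W.getD a' #[])) = true)) ∧
      ∃ preF : Array (Array (Array IntervalD)), preF.size = q * L + min L (TV.S j - q * L) - q * L ∧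
        (∀ i < preF.size, preF.getD i #[] = TV.prodM kitOf wT j (q * L + i) (q * L + min L (TV.S j - q * L) - (q * L + i))) ∧
        (TV.gctxC j L q).claimsOKC (TV.gTI j q) (q * L + min L (TV.S j - q * L)) preF = true := by
  unfold growthRangeC at h
  rw [StageCtx.startNode_eq_nodeAt] at h
  exact growthRunC_sound P j L q _ _ #[] h le_rfl (by simp) (by simp)

/-- **The claims, unpacked (variant C)**: if a later chunk exists (`(q+1)L < S`), the chunk run certified
`prodM (qL) L ⊆ T_q` (as `subsetIM`) and `(|prodM a ((q+1)L − a)|·ω↑)↑ ≤ ũ_a` coordinatewise for every start `a` of chunk `q`.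
[folklore] -/
theorem claimsC_sound {P : ℕ → CoreOut → Bool} {j L q : ℕ} (h : TV.growthRangeC kitOf wT P j L q = true) (hL : 0 < L)
    (hlater : (q + 1) * L < TV.S j) :
    subsetIM TV.base.n (TV.prodM kitOf wT j (q * L) L) (TV.gTI j q) = true ∧
    (∀ a, q * L ≤ a → a < (q + 1) * L → ∀ c < TV.base.n,
        vre (absMulVecUp TV.base.n TV.prec (magM TV.base.n (TV.prodM kitOf wT j a ((q + 1) * L - a))) (TV.ωhiV j)) c ≤
          vre (TV.gU j a) c) := by
  obtain ⟨-, preF, hsz, hpre, hcl⟩ := growthRangeC_sound (TV := TV) (kitOf := kitOf) (wT := wT) h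
  have hend : (q + 1) * L = q * L + L := by ring
  have hmin : min L (TV.S j - q * L) = L := min_eq_left (by omega)
  rw [hmin] at hsz hpre hcl
  unfold GCtx.claimsOKC at hcl
  simp only [gctxC_S, gctxC_n, gctxC_prec, gctxC_q, gctxC_L, gctxC_ωhi, gctxC_U, Bool.or_eq_true, decide_eq_true_eq,
    Bool.and_eq_true, allN_eq_true] at hcl
  rcases hcl with hS | ⟨hT, hU⟩
  · exfalso; omega
  have h0 : 0 < preF.size := by rw [hsz]; omega
  refine ⟨?_, fun a ha1 ha2 c hc => ?_⟩
  · have e := hpre 0 h0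
    rw [Nat.add_zero, show q * L + L - q * L = L by omega] at e
    rw [e] at hT
    exact hT
  · have hi : a - q * L < preF.size := by rw [hsz]; omega
    have hle := le_of_leVec (hU (a - q * L) hi) hc
    rw [hpre (a - q * L) hi] at hle
    have e1 : q * L + (a - q * L) = a := by omega
    have e2 : q * L + L - a = (q + 1) * L - a := by rw [hend]
    rw [e1, e2] at hle
    exact hle

end CertTablesV

end Summit.NavierStokesRegularity.NavierStokesRegularity.Theorems.TaylorModelCert

-- ===== work/GrowthCPairs.lean =====

/-!
# Crux K1b-DR (stmt-NavierStokesRegularity-23954), line `taylor-model` — v3 growth checker VARIANT C, SOUNDNESS part 2: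
# composed chains as ONE matrix product, the transfer chain `RS`, and (R3) (tm-g4 g5)

* `CertTables.matOfKer_kerOf_kiter_add` — **the coordinate matrix of a composed chain is the product of the coordinate
  matrices** (`kiter A s₀ (n+m) = kiter A (s₀+n) m ∘ kiter A s₀ n` on the window); `memMat_kiter_comp` — hence interval products
  of enclosures enclose the composed chain (sign cancellation ACROSS the two pieces retained).
* `memMat_gTI` — the verified claim `prodM (qL) L ⊆ T_q` makes `T_q` an enclosure of every admissible chain over chunk `q`;
  **`memMat_RS`** — `RS j q m = T_{q−1}⋯T_{q−m}` encloses every admissible chain over the `m` chunks before chunk `q`.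
* `facts_atC`, `L1_boundsC`, **`pair_testedC`** (every pair `(a', b)` was tested with the factor `gDC a' b`), `gDC_nonneg`,
  **`hR3a_of_growthC`**, **`hR3b_of_growthC`** — verbatim along v1 (`…FormatVGrowthPairs`) with `W = wVecC`.
MODEL-lattice bookkeeping only (rung TL-M3); nothing here is a statement about the Navier–Stokes equations.
-/

-- the sub-problem namespace repeats the summit name by design (D-0017)
set_option linter.dupNamespace false

namespace Summit.NavierStokesRegularity.NavierStokesRegularity.Theorems.TaylorModelCert

open scoped BigOperators
open Literature.Analysis.FluidPDE.TaoCascade Literature.Analysis.FluidPDE.TaoCascade.TaylorChain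
open Summit.NavierStokesRegularity.NavierStokesRegularity.Theorems.TaylorModelReadout
open Summit.NavierStokesRegularity.NavierStokesRegularity.Theorems.TaylorModelV

/-! ### Composed chains: the coordinate matrix is the matrix product -/

namespace CertTables

variable {K : Type} (T : CertTables K) {cd : CertData} (hKb : cd.Kb = T.Kb) (hKa : cd.Ka = T.Ka)
include hKb hKa

/-- **Matrix of a composed chain** (coordinates `r < n`, any `c`):
`mat (kerOf (kiter A s₀ (n+m))) r c = Σ_{t<n} mat (kerOf (kiter A (s₀+n) m)) r t · mat (kerOf (kiter A s₀ n)) t c`. [folklore] -/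
theorem matOfKer_kerOf_kiter_add (A : ℕ → Ker) (s₀ n m : ℕ) {r : ℕ} (hr : r < T.n) (c : ℕ) :
    T.matOfKer (kerOf (kiter cd A s₀ (n + m))) r c =
      ∑ t ∈ Finset.range T.n, T.matOfKer (kerOf (kiter cd A (s₀ + n) m)) r t * T.matOfKer (kerOf (kiter cd A s₀ n)) t c := by
  have hkr := T.InW_wk hr
  simp only [CertTables.matOfKer]
  show kiter cd A s₀ (n + m) (basisSt (T.wi c) (T.wk c)) (T.wi r) (T.wk r) = _
  rw [kiter_add A s₀ n m (basisSt (T.wi c) (T.wk c)),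
    kiter_eq_kapp_kerOf A (s₀ + n) m _ (T.wi r) (by rw [hKb]; exact hkr.1) (by rw [hKa]; exact hkr.2),
    kapp_apply_of_InW _ _ (T.wi r) (by rw [hKb, hKa]; exact hkr)]
  simp only [toVec]
  rw [T.sum_nW_eq_sum_range cd hKb hKa
    (fun i k => kerOf (kiter cd A (s₀ + n) m) (T.wi r) (T.wk r) i k * kiter cd A s₀ n (basisSt (T.wi c) (T.wk c)) i k)]
  rfl

/-- **Enclosures compose**: if the coordinate matrix of every chain piece over `[s₀, s₀+n)` lies in `P` and that over
`[s₀+n, s₀+n+m)` lies in `Q`, the matrix of the composed chain over `[s₀, s₀+n+m)` lies in `mulII Q P`. [folklore] -/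
theorem memMat_kiter_comp (prec : ℕ) {A : ℕ → Ker} {s₀ n m : ℕ} {P Q : Array (Array IntervalD)}
    (hP : MemMat T.n (T.matOfKer (kerOf (kiter cd A s₀ n))) P)
    (hQ : MemMat T.n (T.matOfKer (kerOf (kiter cd A (s₀ + n) m))) Q) :
    MemMat T.n (T.matOfKer (kerOf (kiter cd A s₀ (n + m)))) (mulII T.n prec Q P) := by
  intro r hr c hc
  rw [T.matOfKer_kerOf_kiter_add hKb hKa A s₀ n m hr c]
  exact memMat_mulII prec hQ hP r hr c hc

end CertTables

namespace CertTablesV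

variable {TV : CertTablesV} {kitOf : ℕ → CoreKit} {wT : ℕ → Array Dyad} {sc : ScalarsV}

section Stage

variable {P : ℕ → CoreOut → Bool} {j L : ℕ} (hL : 0 < L)
  (hGR : ∀ q, q * L < TV.S j → TV.growthRangeC kitOf wT P j L q = true)
include hL hGR

/-! ### The emitted transfer matrices enclose the chains -/

/-- **`T_q` encloses every admissible chain over chunk `q`** (when a later chunk exists, `(q+1)L < S`). [folklore] -/
theorem memMat_gTI {q : ℕ} (hlater : (q + 1) * L < TV.S j) {Ac : ℕ → Ker}
    (hA : ∀ s', q * L ≤ s' → s' < q * L + L →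
      KerMem (TV.toCertDataVW kitOf wT sc) (Ac s') ((TV.toBoxesW kitOf wT).Mlo j s') ((TV.toBoxesW kitOf wT).Mhi j s')) :
    MemMat TV.base.n (TV.base.matOfKer (kerOf (kiter (TV.toCertDataVW kitOf wT sc) Ac (q * L) L))) (TV.gTI j q) := by
  have hq : q * L < TV.S j := by nlinarith
  have hcl := (claimsC_sound (TV := TV) (kitOf := kitOf) (wT := wT) (hGR q hq) hL hlater).1
  exact memMat_of_subsetIM hcl (memMat_prodM (sc := sc) L hA)

/-- **`RS j q m` encloses every admissible chain over the `m` chunks `q−m, …, q−1` before chunk `q`** (`m ≤ q`, `qL < S`).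
[folklore] -/
theorem memMat_RS {q : ℕ} (hq : q * L < TV.S j) (Ac : ℕ → Ker) :
    ∀ m : ℕ, m ≤ q →
      (∀ s', (q - m) * L ≤ s' → s' < q * L →
        KerMem (TV.toCertDataVW kitOf wT sc) (Ac s') ((TV.toBoxesW kitOf wT).Mlo j s') ((TV.toBoxesW kitOf wT).Mhi j s')) →
      MemMat TV.base.n (TV.base.matOfKer (kerOf (kiter (TV.toCertDataVW kitOf wT sc) Ac ((q - m) * L) (m * L))))
        (TV.RS j q m)
  | 0, _, _ => by
    intro r hr c hc
    rw [Nat.zero_mul, matOfKer_kerOf_kiter_zero (sc := sc) Ac _ hr hc]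
    exact memMat_idIM TV.base.n r hr c hc
  | m + 1, hm, hA => by
    -- chunk `c := q − (m+1)` first, then the `m` chunks after it
    set c := q - (m + 1) with hc
    have hqm : q - m = c + 1 := by omega
    have ih := memMat_RS hq Ac m (by omega) (fun s' h1 h2 => hA s' (by rw [hqm] at h1; nlinarith) h2)
    rw [hqm] at ih
    have hlater : (c + 1) * L < TV.S j := lt_of_le_of_lt (Nat.mul_le_mul_right L (by omega)) hq
    have hcq : (c + 1) * L ≤ q * L := Nat.mul_le_mul_right L (by omega)
    have hT := memMat_gTI (sc := sc) hL hGR hlater (Ac := Ac) (fun s' h1 h2 => hA s' h1 (by nlinarith))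
    have e1 : (m + 1) * L = L + m * L := by ring
    have e2 : (c + 1) * L = c * L + L := by ring
    rw [e1]
    show MemMat TV.base.n _ (mulII TV.base.n TV.prec (TV.RS j q m) (TV.gTI j (q - 1 - m)))
    have e3 : q - 1 - m = c := by omega
    rw [e3]
    rw [e2] at ih
    exact TV.base.memMat_kiter_comp cd_Kb cd_Ka TV.prec hT ih

/-! ### From the chunk Booleans to (R3) -/

/-- The run facts AT sub-step `t < S` (chunk `t/L`). [folklore] -/
theorem facts_atC {t : ℕ} (ht : t < TV.S j) :
    ((TV.ctxOfW kitOf wT j).subStep t ((TV.ctxOfW kitOf wT j).nodeAt t)).ok = true ∧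
    P t ((TV.ctxOfW kitOf wT j).subStep t ((TV.ctxOfW kitOf wT j).nodeAt t)).core = true ∧
    (Dyad.ble Dyad.zero (TV.coreVW kitOf wT j t).L1 = true ∧ Dyad.ble (TV.coreVW kitOf wT j t).L1 (dget (TV.gL1 j) t) = true) ∧
    (∀ i', i' < t + 1 - t / L * L → (TV.gctx j L (t / L)).pairTest (t / L * L + i') (t + 1)
      ((TV.gctx j L (t / L)).facOf (TV.prodM kitOf wT j (t / L * L + i') (t + 1 - (t / L * L + i'))) (TV.ωhiV j)) = true) ∧
    (TV.gctx j L (t / L)).pairTest (t + 1) (t + 1) ((TV.gctx j L (t / L)).facOf (idIM TV.base.n) (TV.ωhiV j)) = true ∧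
    (∀ a' < t / L * L, (TV.gctx j L (t / L)).pairTest a' (t + 1)
      ((TV.gctx j L (t / L)).facOf (TV.prodM kitOf wT j (t / L * L) (t + 1 - t / L * L))
        ((TV.gctxC j L (t / L)).W.getD a' #[])) = true) := by
  have h1 : t / L * L ≤ t := Nat.div_mul_le_self t L
  have h2 : t < t / L * L + L := Nat.lt_div_mul_add hL
  have hq : t / L * L < TV.S j := lt_of_le_of_lt h1 ht
  have hi : t - t / L * L < min L (TV.S j - t / L * L) := by
    apply lt_min <;> omega
  have h := (growthRangeC_sound (TV := TV) (kitOf := kitOf) (wT := wT) (hGR (t / L) hq)).1 (t - t / L * L) hi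
  have e : t / L * L + (t - t / L * L) = t := by omega
  rw [e] at h
  exact h

/-- `0 ≤ L1_t ≤ gL1[t]` as reals, for `t < S`. [folklore] -/
theorem L1_boundsC {t : ℕ} (ht : t < TV.S j) :
    0 ≤ ((TV.coreVW kitOf wT j t).L1).toReal ∧ ((TV.coreVW kitOf wT j t).L1).toReal ≤ (dget (TV.gL1 j) t).toReal := by
  obtain ⟨-, -, ⟨h0, h1⟩, -⟩ := facts_atC (TV := TV) (kitOf := kitOf) (wT := wT) hL hGR ht
  have h0' := (Dyad.ble_iff _ _).1 h0
  rw [Dyad.toReal_zero] at h0'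
  exact ⟨h0', (Dyad.ble_iff _ _).1 h1⟩

/-- **Every pair `(a', b)`, `a' ≤ b`, `1 ≤ b ≤ S`, was tested with the factor `gDC a' b`.** [folklore] -/
theorem pair_testedC {a' b : ℕ} (hb1 : 1 ≤ b) (hbS : b ≤ TV.S j) (hab : a' ≤ b) :
    (TV.gctx j L ((b - 1) / L)).pairTest a' b (TV.gDC kitOf wT j L a' b) = true := by
  have ht : b - 1 < TV.S j := by omega
  obtain ⟨-, -, -, hIn, hDiag, hOut⟩ := facts_atC (TV := TV) (kitOf := kitOf) (wT := wT) hL hGR ht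
  set qb := (b - 1) / L with hqb
  have h1 : qb * L ≤ b - 1 := Nat.div_mul_le_self _ L
  have h2 : b - 1 < qb * L + L := Nat.lt_div_mul_add hL
  have eb : b - 1 + 1 = b := by omega
  rw [eb] at hIn hDiag hOut
  rcases Nat.lt_or_ge a' (qb * L) with hlt | hge
  · -- earlier start: split factor with `wVecC`
    have hdiv : a' / L < qb := (Nat.div_lt_iff_lt_mul hL).2 hlt
    have hW : (TV.gctxC j L qb).W.getD a' #[] = TV.wVecC j L qb a' := W_gctxC (TV := TV) hlt
    have h := hOut a' hlt
    rw [hW] at h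
    have hnot : ¬ b ≤ (a' / L + 1) * L := by
      have : (a' / L + 1) * L ≤ qb * L := Nat.mul_le_mul_right L hdiv
      omega
    unfold gDC
    rw [if_neg hnot]
    exact h
  · rcases Nat.lt_or_ge a' b with hltb | hgeb
    · -- start inside the chunk: direct factor
      have hi' : a' - qb * L < b - qb * L := by omega
      have h := hIn (a' - qb * L) hi'
      have e1 : qb * L + (a' - qb * L) = a' := by omega
      rw [e1] at h
      have hdiv : a' / L = qb := div_eq_of_chunk hL hge (by omega)
      have hpos : b ≤ (a' / L + 1) * L := by rw [hdiv]; linarith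
      unfold gDC
      rw [if_pos hpos, hdiv, facOf_gctx j L qb qb]
      exact h
    · -- `a' = b`: identity factor
      have hab' : a' = b := le_antisymm hab hgeb
      subst hab'
      have hpos : a' ≤ (a' / L + 1) * L := by
        have := Nat.lt_div_mul_add (a := a') hL; linarith
      unfold gDC
      rw [if_pos hpos, Nat.sub_self, facOf_gctx j L (a' / L) qb]
      exact hDiag

omit hL hGR in
/-- `0 ≤ gDC`. [folklore] -/
theorem gDC_nonneg (a b : ℕ) : 0 ≤ (TV.gDC kitOf wT j L a b).toReal := by
  unfold gDC; split_ifs <;> exact GCtx.facOf_nonneg _ _ _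

/-- **(R3a) from the variant-C growth Booleans.** [folklore] -/
theorem hR3a_of_growthC (a b : ℕ) (ha : a < TV.S j) (hab : a + 1 ≤ b) (hb : b ≤ TV.S j) :
    (TV.toCertDataVW kitOf wT sc).L1 j a * TV.GrC kitOf wT j L (a + 1) b ≤ TV.ΛTr j ∧
    (b < TV.S j → (TV.toCertDataVW kitOf wT sc).L1 j a * TV.GrC kitOf wT j L (a + 1) b *
      (TV.toCertDataVW kitOf wT sc).L1 j b ≤ (TV.toCertDataVW kitOf wT sc).Λ j) := by
  have hpt := pair_testedC (TV := TV) (kitOf := kitOf) (wT := wT) hL hGR (a' := a + 1) (b := b) (by omega) hb hab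
  have hgb : b < TV.S j → 0 ≤ (dget (TV.gL1 j) b).toReal := fun hb' =>
    (L1_boundsC (TV := TV) (kitOf := kitOf) (wT := wT) hL hGR hb').1.trans (L1_boundsC hL hGR hb').2
  obtain ⟨h1, h2⟩ := pairTest_sound (TV := TV) hpt (by omega) hgb
  simp only [Nat.add_sub_cancel] at h1 h2
  obtain ⟨hL1a0, hL1a⟩ := L1_boundsC (TV := TV) (kitOf := kitOf) (wT := wT) hL hGR ha
  have hG0 := gDC_nonneg (TV := TV) (kitOf := kitOf) (wT := wT) (j := j) (L := L) (a + 1) b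
  have hΛdes : ((IntervalD.ofQS2 TV.prec (TV.stageV j).Λdes).lo).toReal ≤ TV.ΛTr j := (IntervalD.mem_ofQS2 TV.prec _).1
  have hΛ : ((IntervalD.ofQS2 TV.prec (TV.base.stage j).Λ).lo).toReal ≤ (TV.toCertDataVW kitOf wT sc).Λ j :=
    (IntervalD.mem_ofQS2 TV.prec _).1
  rw [cd_L1]
  unfold GrC
  constructor
  · calc ((TV.coreVW kitOf wT j a).L1).toReal * (TV.gDC kitOf wT j L (a + 1) b).toReal
        ≤ (dget (TV.gL1 j) a).toReal * (TV.gDC kitOf wT j L (a + 1) b).toReal := mul_le_mul_of_nonneg_right hL1a hG0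
      _ ≤ _ := h1.trans hΛdes
  · intro hb'
    obtain ⟨hL1b0, hL1b⟩ := L1_boundsC (TV := TV) (kitOf := kitOf) (wT := wT) hL hGR hb'
    rw [cd_L1]
    calc ((TV.coreVW kitOf wT j a).L1).toReal * (TV.gDC kitOf wT j L (a + 1) b).toReal * ((TV.coreVW kitOf wT j b).L1).toReal
        ≤ (dget (TV.gL1 j) a).toReal * (TV.gDC kitOf wT j L (a + 1) b).toReal * (dget (TV.gL1 j) b).toReal :=
          mul_le_mul (mul_le_mul_of_nonneg_right hL1a hG0) hL1b hL1b0 (mul_nonneg (hL1a0.trans hL1a) hG0)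
      _ ≤ _ := (h2 hb').trans hΛ

/-- **(R3b) from `checkL1` and the variant-C growth Booleans.** [folklore] -/
theorem hR3b_of_growthC (hcL : TV.checkL1 j = true) (a : ℕ) (ha : a < TV.S j) :
    (TV.toCertDataVW kitOf wT sc).L1 j a ≤ (TV.toCertDataVW kitOf wT sc).Λ j := by
  unfold checkL1 at hcL
  simp only [Bool.and_eq_true, allN_eq_true, decide_eq_true_eq] at hcL
  have h := (Dyad.ble_iff _ _).1 (hcL.2 a ha)
  have hΛ : ((IntervalD.ofQS2 TV.prec (TV.base.stage j).Λ).lo).toReal ≤ (TV.toCertDataVW kitOf wT sc).Λ j :=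
    (IntervalD.mem_ofQS2 TV.prec _).1
  rw [cd_L1]
  exact ((L1_boundsC (TV := TV) (kitOf := kitOf) (wT := wT) hL hGR ha).2.trans h).trans hΛ

end Stage

end CertTablesV

end Summit.NavierStokesRegularity.NavierStokesRegularity.Theorems.TaylorModelCert

-- ===== work/GrowthCSound.lean =====

/-!
# Crux K1b-DR (stmt-NavierStokesRegularity-23954), line `taylor-model` — v3 growth checker VARIANT C, SOUNDNESS part 3:
# (R2) with interval chunk transfers, and the composer's inputs for all stages (tm-g4 g5)

**`transport_boundC`** — an admissible chain from `s₀` (chunk `c = s₀/L`) to the start `qL` of a later chunk `q` maps the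
`r·ω`-ball into the box `r·wVecC j L q s₀`: leg 1 over the rest of chunk `c` by the verified start-vector claim `ũ_{s₀}` (as v1),
leg 2 over the chunks `c+1, …, q−1` as ONE kernel whose coordinate matrix lies in the interval product `RS j q (q−1−c)` of the
verified transfer claims (`memMat_RS`; cancellation across those chunks retained), then one magnitude (`absLeW_kiter_of_prodMem`).
**`hR2_inChunkC`**, **`hR2_crossC`**, **`hR2_of_growthC`** — clause (R2) for all pairs with `G := GrC`; `hR2_allC`, `hR3a_allC`,
`hR3b_allC`, `steps_of_growthC` — the inputs of `k1bDR_of_checksVR'` (binders verbatim as in `…FormatVGrowthSound`; (R0)/(R1)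
are v1's `hR0_all`/`hR1_all`, unchanged). MODEL-lattice bookkeeping only (rung TL-M3); nothing here is a statement about the
Navier–Stokes equations; K1b-DR is NOT proved here (that needs an emitted certificate whose Booleans evaluate to `true`).
-/

-- the sub-problem namespace repeats the summit name by design (D-0017)
set_option linter.dupNamespace false

namespace Summit.NavierStokesRegularity.NavierStokesRegularity.Theorems.TaylorModelCert

open scoped BigOperators
open Literature.Analysis.FluidPDE.TaoCascade Literature.Analysis.FluidPDE.TaoCascade.TaylorChain
open Summit.NavierStokesRegularity.NavierStokesRegularity.Theorems.TaylorModelReadout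
open Summit.NavierStokesRegularity.NavierStokesRegularity.Theorems.TaylorModelV

/-- Row sums of magnitudes against a dyadic vector are below the upward product `(|P|·u)↑`. [folklore] -/
theorem sum_mag_le_absMulVecUp {n : ℕ} (prec : ℕ) (P : Array (Array IntervalD)) (u : Array Dyad) {r' : ℕ} (hr' : r' < n) :
    ∑ t ∈ Finset.range n, (IntervalD.mag (imget P r' t)).toReal * vre u t ≤ vre (absMulVecUp n prec (magM n P) u) r' :=
  sum_le_absMulVecUp prec (x := fun r t => (IntervalD.mag (imget P r t)).toReal * vre u t)
    (fun r hr t ht => by rw [dre_magM P hr ht]) hr'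

namespace CertTablesV

variable {TV : CertTablesV} {kitOf : ℕ → CoreKit} {wT : ℕ → Array Dyad} {sc : ScalarsV}

/-! ### From the chunk Booleans to (R2), variant C -/

section Stage

variable {P : ℕ → CoreOut → Bool} {j L : ℕ} (hL : 0 < L)
  (hGR : ∀ q, q * L < TV.S j → TV.growthRangeC kitOf wT P j L q = true)
include hL hGR

variable (hω : ∀ k, 0 < (TV.toCertDataVW kitOf wT sc).ω j k)
include hω

omit hL hGR in
/-- **(R2), in-chunk pairs** (the in-chunk factor is v1's). [folklore] -/
theorem hR2_inChunkC {s₀ s₁ : ℕ} (h01 : s₀ ≤ s₁) (hin : s₁ ≤ (s₀ / L + 1) * L) (Ac : ℕ → Ker)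
    (hA : ∀ s', s₀ ≤ s' → s' < s₁ →
      KerMem (TV.toCertDataVW kitOf wT sc) (Ac s') ((TV.toBoxesW kitOf wT).Mlo j s') ((TV.toBoxesW kitOf wT).Mhi j s'))
    (v : Fin 4 → ℤ → ℝ) (r : ℝ) (hr : 0 ≤ r) (hv : (TV.toCertDataVW kitOf wT sc).InBall j v r) :
    (TV.toCertDataVW kitOf wT sc).InBall j (kiter (TV.toCertDataVW kitOf wT sc) Ac s₀ (s₁ - s₀) v)
      (TV.GrC kitOf wT j L s₀ s₁ * r) := by
  unfold GrC gDC
  rw [if_pos hin]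
  refine TV.base.inBall_kiter_of_memMat cd_Kb cd_Ka
    (memMat_prodM (sc := sc) (s₁ - s₀) fun s' h1 h2 => hA s' h1 (by omega)) (fun r' hr' => ?_) hr hv
  exact (rowsum_omega_le_ωhi (sc := sc) (j := j) _ hr').trans (rowsum_le_facOf (sc := sc) j L _ hω _ _ hr')

omit hω in
/-- **TRANSPORT TO A LATER CHUNK START (variant C)**: for `s₀ < qL` (so `s₀/L < q`) with `qL < S`, an admissible chain from `s₀`
over `qL − s₀` sub-steps maps the `r·ω`-ball into the box `r · wVecC j L q s₀` (coordinatewise). [folklore] -/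
theorem transport_boundC {s₀ q : ℕ} (hsq : s₀ < q * L) (hq : q * L < TV.S j) (Ac : ℕ → Ker)
    (hA : ∀ s', s₀ ≤ s' → s' < q * L →
      KerMem (TV.toCertDataVW kitOf wT sc) (Ac s') ((TV.toBoxesW kitOf wT).Mlo j s') ((TV.toBoxesW kitOf wT).Mhi j s'))
    (v : Fin 4 → ℤ → ℝ) (r : ℝ) (hr : 0 ≤ r) (hv : (TV.toCertDataVW kitOf wT sc).InBall j v r) :
    AbsLeW (TV.toCertDataVW kitOf wT sc) (kiter (TV.toCertDataVW kitOf wT sc) Ac s₀ (q * L - s₀) v)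
      (fun i k => r * vre (TV.wVecC j L q s₀) (TV.base.idx i k)) := by
  -- the chunk `c` of `s₀` and the number `m` of whole chunks between it and chunk `q` (linear bookkeeping for `omega`)
  obtain ⟨c, hc⟩ : ∃ c, s₀ / L = c := ⟨_, rfl⟩
  have h1 : c * L ≤ s₀ := hc ▸ Nat.div_mul_le_self s₀ L
  have h2 : s₀ < c * L + L := hc ▸ Nat.lt_div_mul_add hL
  have hcq : c < q := hc ▸ (Nat.div_lt_iff_lt_mul hL).2 hsq
  obtain ⟨m, hm⟩ := Nat.exists_eq_add_of_lt hcq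
  have hX : (c + 1) * L = c * L + L := add_one_mul c L
  have hQ : q * L = (c + 1) * L + m * L := by rw [hm]; ring
  have hlater : (c + 1) * L < TV.S j := by omega
  have hcS : c * L < TV.S j := by omega
  -- LEG 1: the rest of chunk `c`, by the verified start-vector claim `ũ_{s₀}`
  have hmem1 := memMat_prodM (sc := sc) (j := j) (a := s₀) (A := Ac) ((c + 1) * L - s₀)
    fun s' h1' h2' => hA s' h1' (by omega)
  have hK1 := TV.base.kerMem_of_memMat_kiter cd_Kb cd_Ka hmem1
  have hb1 := absLeW_kiter_of_prodMem hK1 (v := v) (b := fun i k => r * (TV.toCertDataVW kitOf wT sc).ω j k)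
    (fun i k hk1 hk2 => hv i k hk1 hk2)
  have hcl := (claimsC_sound (TV := TV) (kitOf := kitOf) (wT := wT) (hGR c hcS) hL hlater).2 s₀ h1 (by omega)
  have hleg1 : AbsLeW (TV.toCertDataVW kitOf wT sc)
      (kiter (TV.toCertDataVW kitOf wT sc) Ac s₀ ((c + 1) * L - s₀) v) (fun i k => r * vre (TV.gU j s₀) (TV.base.idx i k)) := by
    intro i' k' hk1' hk2'
    refine (hb1 i' k' hk1' hk2').trans ?_
    have hrow : ∀ r' < TV.base.n, ∑ t ∈ Finset.range TV.base.n,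
        (IntervalD.mag (imget (TV.prodM kitOf wT j s₀ ((c + 1) * L - s₀)) r' t)).toReal *
          (r * (TV.toCertDataVW kitOf wT sc).ω j (TV.base.wk t)) ≤ r * vre (TV.gU j s₀) r' := by
      intro r' hr'
      have e : ∑ t ∈ Finset.range TV.base.n, (IntervalD.mag (imget (TV.prodM kitOf wT j s₀ ((c + 1) * L - s₀)) r' t)).toReal *
            (r * (TV.toCertDataVW kitOf wT sc).ω j (TV.base.wk t))
          = r * ∑ t ∈ Finset.range TV.base.n, (IntervalD.mag (imget (TV.prodM kitOf wT j s₀ ((c + 1) * L - s₀)) r' t)).toReal *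
            (TV.toCertDataVW kitOf wT sc).ω j (TV.base.wk t) := by
        rw [Finset.mul_sum]; exact Finset.sum_congr rfl fun t _ => by ring
      rw [e]
      refine mul_le_mul_of_nonneg_left ?_ hr
      refine (rowsum_omega_le_ωhi (sc := sc) (j := j) _ hr').trans ?_
      exact (sum_le_absMulVecUp TV.prec (fun r hr t ht => by rw [dre_magM _ hr ht]) hr').trans (hcl r' hr')
    have hw := TV.base.rowsum_window_le_of_coord cd_Kb cd_Ka (TV.prodM kitOf wT j s₀ ((c + 1) * L - s₀))
      (fun t => r * (TV.toCertDataVW kitOf wT sc).ω j (TV.base.wk t)) (fun r' => r * vre (TV.gU j s₀) r') hrow i' hk1' hk2'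
    refine le_trans (le_of_eq (Finset.sum_congr rfl fun c' _ => ?_)) hw
    rw [TV.base.wk_idx _ (by rw [← cd_Kb (TV := TV) (kitOf := kitOf) (wT := wT) (sc := sc),
      ← cd_Ka (TV := TV) (kitOf := kitOf) (wT := wT) (sc := sc)]; exact shellOf_mem _ c')]
  -- LEG 2: the `m` whole chunks `c+1, …, q−1` as ONE kernel in `RS j q m`
  have hmq : m ≤ q := by omega
  have hqm : q - m = c + 1 := by omega
  have hmem2 := memMat_RS (sc := sc) hL hGR hq Ac m hmq (fun s' h1' h2' => hA s' (by rw [hqm] at h1'; omega) h2')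
  rw [hqm] at hmem2
  have hK2 := TV.base.kerMem_of_memMat_kiter cd_Kb cd_Ka hmem2
  have hb2 := absLeW_kiter_of_prodMem hK2 hleg1
  -- compose the two legs
  have e1 : (c + 1) * L - s₀ + m * L = q * L - s₀ := by omega
  have hsplit : kiter (TV.toCertDataVW kitOf wT sc) Ac s₀ (q * L - s₀) v =
      kiter (TV.toCertDataVW kitOf wT sc) Ac ((c + 1) * L) (m * L)
        (kiter (TV.toCertDataVW kitOf wT sc) Ac s₀ ((c + 1) * L - s₀) v) := by
    rw [← e1, kiter_add]
    congr 1; omega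
  have em : q - 1 - s₀ / L = m := by omega
  have hWeq : TV.wVecC j L q s₀ = absMulVecUp TV.base.n TV.prec (magM TV.base.n (TV.RS j q m)) (TV.gU j s₀) := by
    unfold wVecC; rw [em]
  intro i' k' hk1' hk2'
  rw [hsplit, hWeq]
  refine (hb2 i' k' hk1' hk2').trans ?_
  have hrow : ∀ r' < TV.base.n, ∑ t ∈ Finset.range TV.base.n,
      (IntervalD.mag (imget (TV.RS j q m) r' t)).toReal * (r * vre (TV.gU j s₀) t) ≤
        r * vre (absMulVecUp TV.base.n TV.prec (magM TV.base.n (TV.RS j q m)) (TV.gU j s₀)) r' := by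
    intro r' hr'
    have e : ∑ t ∈ Finset.range TV.base.n, (IntervalD.mag (imget (TV.RS j q m) r' t)).toReal * (r * vre (TV.gU j s₀) t) =
        r * ∑ t ∈ Finset.range TV.base.n, (IntervalD.mag (imget (TV.RS j q m) r' t)).toReal * vre (TV.gU j s₀) t := by
      rw [Finset.mul_sum]; exact Finset.sum_congr rfl fun t _ => by ring
    rw [e]
    exact mul_le_mul_of_nonneg_left (sum_mag_le_absMulVecUp TV.prec (TV.RS j q m) (TV.gU j s₀) hr') hr
  exact TV.base.rowsum_window_le_of_coord cd_Kb cd_Ka _ (fun t => r * vre (TV.gU j s₀) t)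
    (fun r' => r * vre (absMulVecUp TV.base.n TV.prec (magM TV.base.n (TV.RS j q m)) (TV.gU j s₀)) r') hrow i' hk1' hk2'

/-- **(R2), cross-chunk pairs (variant C).** [folklore] -/
theorem hR2_crossC {s₀ s₁ : ℕ} (hS : s₁ ≤ TV.S j) (hout : ¬ s₁ ≤ (s₀ / L + 1) * L) (Ac : ℕ → Ker)
    (hA : ∀ s', s₀ ≤ s' → s' < s₁ →
      KerMem (TV.toCertDataVW kitOf wT sc) (Ac s') ((TV.toBoxesW kitOf wT).Mlo j s') ((TV.toBoxesW kitOf wT).Mhi j s'))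
    (v : Fin 4 → ℤ → ℝ) (r : ℝ) (hr : 0 ≤ r) (hv : (TV.toCertDataVW kitOf wT sc).InBall j v r) :
    (TV.toCertDataVW kitOf wT sc).InBall j (kiter (TV.toCertDataVW kitOf wT sc) Ac s₀ (s₁ - s₀) v)
      (TV.GrC kitOf wT j L s₀ s₁ * r) := by
  have h2 : s₀ < s₀ / L * L + L := Nat.lt_div_mul_add hL
  push Not at hout
  set qb := (s₁ - 1) / L with hqb
  have hb1 : qb * L ≤ s₁ - 1 := Nat.div_mul_le_self _ L
  have hb2 : s₁ - 1 < qb * L + L := Nat.lt_div_mul_add hL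
  have hq : s₀ / L + 1 ≤ qb := (Nat.le_div_iff_mul_le hL).2 (by omega)
  have hX : (s₀ / L + 1) * L = s₀ / L * L + L := add_one_mul _ L
  have hsq : s₀ < qb * L := by
    have : (s₀ / L + 1) * L ≤ qb * L := Nat.mul_le_mul_right L hq
    omega
  have hqS : qb * L < TV.S j := by omega
  have ht := transport_boundC (TV := TV) (kitOf := kitOf) (wT := wT) (sc := sc) hL hGR hsq hqS Ac
    (fun s' h1' h2' => hA s' h1' (by omega)) v r hr hv
  -- split at `qb·L`
  have e1 : s₁ - s₀ = (qb * L - s₀) + (s₁ - qb * L) := by omega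
  rw [e1, kiter_add, show s₀ + (qb * L - s₀) = qb * L by omega]
  have hmem := memMat_prodM (sc := sc) (j := j) (a := qb * L) (A := Ac) (s₁ - qb * L) fun s' h1' h2' =>
    hA s' (by omega) (by omega)
  have hK := TV.base.kerMem_of_memMat_kiter cd_Kb cd_Ka hmem
  have hb := absLeW_kiter_of_prodMem hK ht
  unfold GrC gDC
  rw [if_neg (by omega)]
  intro i k hk1 hk2
  refine (hb i k hk1 hk2).trans ?_
  have hrow : ∀ r' < TV.base.n, ∑ t ∈ Finset.range TV.base.n,
      (IntervalD.mag (imget (TV.prodM kitOf wT j (qb * L) (s₁ - qb * L)) r' t)).toReal * (r * vre (TV.wVecC j L qb s₀) t) ≤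
      ((TV.gctx j L ((s₁ - 1) / L)).facOf (TV.prodM kitOf wT j ((s₁ - 1) / L * L) (s₁ - (s₁ - 1) / L * L))
          (TV.wVecC j L ((s₁ - 1) / L) s₀)).toReal * r * (TV.toCertDataVW kitOf wT sc).ω j (TV.base.wk r') := by
    intro r' hr'
    have e : ∑ t ∈ Finset.range TV.base.n,
        (IntervalD.mag (imget (TV.prodM kitOf wT j (qb * L) (s₁ - qb * L)) r' t)).toReal * (r * vre (TV.wVecC j L qb s₀) t) =
        r * ∑ t ∈ Finset.range TV.base.n,
          (IntervalD.mag (imget (TV.prodM kitOf wT j (qb * L) (s₁ - qb * L)) r' t)).toReal * vre (TV.wVecC j L qb s₀) t := by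
      rw [Finset.mul_sum]; exact Finset.sum_congr rfl fun t _ => by ring
    rw [e, ← hqb]
    have hf := rowsum_le_facOf (sc := sc) j L qb hω (TV.prodM kitOf wT j (qb * L) (s₁ - qb * L)) (TV.wVecC j L qb s₀) hr'
    calc r * _ ≤ r * (((TV.gctx j L qb).facOf (TV.prodM kitOf wT j (qb * L) (s₁ - qb * L)) (TV.wVecC j L qb s₀)).toReal *
          (TV.toCertDataVW kitOf wT sc).ω j (TV.base.wk r')) := mul_le_mul_of_nonneg_left hf hr
      _ = _ := by ring
  have hw := TV.base.rowsum_window_le_of_coord cd_Kb cd_Ka _ (fun t => r * vre (TV.wVecC j L qb s₀) t) _ hrow i hk1 hk2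
  refine hw.trans (le_of_eq ?_)
  rw [TV.base.wk_idx i (by rw [← cd_Kb (TV := TV) (kitOf := kitOf) (wT := wT) (sc := sc),
    ← cd_Ka (TV := TV) (kitOf := kitOf) (wT := wT) (sc := sc)]; exact ⟨hk1, hk2⟩)]

/-- **(R2) from the variant-C growth Booleans** (all pairs `s₀ ≤ s₁ ≤ S`). [folklore] -/
theorem hR2_of_growthC (s₀ s₁ : ℕ) (h01 : s₀ ≤ s₁) (hS : s₁ ≤ TV.S j) (Ac : ℕ → Ker)
    (hA : ∀ s', s₀ ≤ s' → s' < s₁ →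
      KerMem (TV.toCertDataVW kitOf wT sc) (Ac s') ((TV.toBoxesW kitOf wT).Mlo j s') ((TV.toBoxesW kitOf wT).Mhi j s'))
    (v : Fin 4 → ℤ → ℝ) (r : ℝ) (hr : 0 ≤ r) (hv : (TV.toCertDataVW kitOf wT sc).InBall j v r) :
    (TV.toCertDataVW kitOf wT sc).InBall j (kiter (TV.toCertDataVW kitOf wT sc) Ac s₀ (s₁ - s₀) v)
      (TV.GrC kitOf wT j L s₀ s₁ * r) := by
  by_cases hin : s₁ ≤ (s₀ / L + 1) * L
  · exact hR2_inChunkC (sc := sc) hω h01 hin Ac hA v r hr hv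
  · exact hR2_crossC (sc := sc) hL hGR hω hS hin Ac hA v r hr hv

end Stage

/-! ### Variant C: the composer's inputs for all stages -/

section All

variable {L : ℕ} (hL : 0 < L) {Pj : ℕ → ℕ → CoreOut → Bool}
  (hGR : ∀ j, j ≤ TV.base.N₀ → ∀ q, q * L < TV.S j → TV.growthRangeC kitOf wT (Pj j) j L q = true)
  (hcL : ∀ j, j ≤ TV.base.N₀ → TV.checkL1 j = true)
  (hSN : (TV.toCertDataVW kitOf wT sc).StageNumerics)

include hL hGR hSN in
/-- (R2) for all stages (variant C). [folklore] -/
theorem hR2_allC : ∀ j, j ≤ TV.base.N₀ → ∀ s₀ s₁, s₀ ≤ s₁ → s₁ ≤ (TV.toCertDataVW kitOf wT sc).S j → ∀ Ac : ℕ → Ker,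
    (∀ s', s₀ ≤ s' → s' < s₁ →
      KerMem (TV.toCertDataVW kitOf wT sc) (Ac s') ((TV.toBoxesW kitOf wT).Mlo j s') ((TV.toBoxesW kitOf wT).Mhi j s')) →
    ∀ (v : Fin 4 → ℤ → ℝ) (r : ℝ), 0 ≤ r → (TV.toCertDataVW kitOf wT sc).InBall j v r →
      (TV.toCertDataVW kitOf wT sc).InBall j (kiter (TV.toCertDataVW kitOf wT sc) Ac s₀ (s₁ - s₀) v)
        (TV.GrC kitOf wT j L s₀ s₁ * r) :=
  fun j hj s₀ s₁ h01 hS Ac hA v r hr hv =>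
    hR2_of_growthC (sc := sc) hL (hGR j hj) (hSN.1 j hj).2.2.2.2.2.2.1 s₀ s₁ h01 hS Ac hA v r hr hv

include hL hGR in
/-- (R3a) for all stages (variant C). [folklore] -/
theorem hR3a_allC : ∀ j, j ≤ TV.base.N₀ → ∀ a b, a < (TV.toCertDataVW kitOf wT sc).S j → a + 1 ≤ b →
    b ≤ (TV.toCertDataVW kitOf wT sc).S j →
    (TV.toCertDataVW kitOf wT sc).L1 j a * TV.GrC kitOf wT j L (a + 1) b ≤ TV.ΛTr j ∧
    (b < (TV.toCertDataVW kitOf wT sc).S j →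
      (TV.toCertDataVW kitOf wT sc).L1 j a * TV.GrC kitOf wT j L (a + 1) b * (TV.toCertDataVW kitOf wT sc).L1 j b ≤
        (TV.toCertDataVW kitOf wT sc).Λ j) :=
  fun j hj a b ha hab hb => hR3a_of_growthC (sc := sc) hL (hGR j hj) a b ha hab hb

include hL hGR hcL in
/-- (R3b) for all stages (variant C). [folklore] -/
theorem hR3b_allC : ∀ j, j ≤ TV.base.N₀ → ∀ a, a < (TV.toCertDataVW kitOf wT sc).S j →
    (TV.toCertDataVW kitOf wT sc).L1 j a ≤ (TV.toCertDataVW kitOf wT sc).Λ j :=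
  fun j hj a ha => hR3b_of_growthC (sc := sc) hL (hGR j hj) (hcL j hj) a ha

include hL hGR in
/-- The variant-C chunk runs also deliver the chain Booleans (`ChecksOK.steps`) and the caller's per-sub-step predicate.
[folklore] -/
theorem steps_of_growthC : ∀ j, j ≤ TV.base.N₀ → ∀ s, s < TV.S j →
    ((TV.ctxOfW kitOf wT j).subStep s ((TV.ctxOfW kitOf wT j).nodeAt s)).ok = true ∧
    Pj j s ((TV.ctxOfW kitOf wT j).subStep s ((TV.ctxOfW kitOf wT j).nodeAt s)).core = true := by
  intro j hj s hs
  obtain ⟨h1, h2, -⟩ := facts_atC (TV := TV) (kitOf := kitOf) (wT := wT) hL (hGR j hj) hs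
  exact ⟨h1, h2⟩

end All

end CertTablesV

end Summit.NavierStokesRegularity.NavierStokesRegularity.Theorems.TaylorModelCert

-- ===== work/CloserVC.lean =====

/-!
# Crux K1b-DR (stmt-NavierStokesRegularity-23954), line `taylor-model` — v3 certificate: the CLOSER for the growth checker
# VARIANT C (interval chunk transfers; tm-g4 g5)

`CertTablesV.k1bDR_of_checksVRGC'` — `k1bDR_of_checksVRG'` (tree `…CertificateCloserV`) with the chunk runs
`growthRangeC … j L q` of `…CertificateFormatVGrowthC` (emitted INTERVAL transfer matrices `T_q`, cross-chunk factor
`|P(b←C_q)|·|T_{q−1}⋯T_{c+1}|·ũ_a`) in place of `growthRange`; `G := GrC … L`, `ΛT := ΛTr`; every other binder verbatim.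
A separate module so that nothing landed is touched. MODEL-lattice bookkeeping only (rung TL-M3); nothing here is a statement
about the Navier–Stokes equations; K1b-DR is NOT proved here (that needs an emitted certificate whose Booleans evaluate to `true`).
-/

-- the sub-problem namespace repeats the summit name by design (D-0017)
set_option linter.dupNamespace false

namespace Summit.NavierStokesRegularity.NavierStokesRegularity.Theorems.TaylorModelCert

namespace CertTablesV

variable (TV : CertTablesV) (kitOf : ℕ → CoreKit) (wT : ℕ → Array Dyad)

/-- **THE v3 CLOSER FROM BOOLEANS, GROWTH VARIANT C** (interval chunk transfers): as `k1bDR_of_checksVRG'` with the chunk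
runs `growthRangeC … j L q` (`G := GrC … L`). [folklore] -/
theorem k1bDR_of_checksVRGC' (sc : ScalarsV) (A : ReadoutAux QS2) (B : StageAux QS2) (B'' : StaticAux QS2)
    (hcoef : TV.base.checkCoef = true) (hS : TV.base.checkStatic B'' = true)
    (hSN : TV.base.checkStageNumerics A B = true) (hk : KitOK TV kitOf)
    (hnode0 : ∀ j, j ≤ TV.base.N₀ → nodeOK TV.base.n TV.prec (TV.ctxOfW kitOf wT j).N0 = true)
    (hrB : ∀ j, j ≤ TV.base.N₀ → nonnegVec TV.base.n (TV.stageV j).rB = true)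
    (hK : CoreChecksOK TV wT) (hE : ∀ j, j ≤ TV.base.N₀ → TV.checkEntryV j = true)
    (hchk' : TV.checkReadouts' kitOf wT A = true) {L : ℕ} (hL : 0 < L)
    (hGR : ∀ j, j ≤ TV.base.N₀ → ∀ q, q * L < TV.S j →
      TV.growthRangeC kitOf wT (fun _ co => TV.base.testR4 TV.MB (TV.AB j) co) j L q = true)
    (hcL : ∀ j, j ≤ TV.base.N₀ → TV.checkL1 j = true) (hc0 : ∀ j, j ≤ TV.base.N₀ → TV.checkR0 j = true)
    (hc1 : ∀ j, j ≤ TV.base.N₀ → TV.checkR1 wT j = true) :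
    Summit.NavierStokesRegularity.NavierStokesRegularity.Theses.ExactWindowRungThree.DerivativeEnclosureCertificateR :=
  have hsteps := steps_of_growthC (TV := TV) (kitOf := kitOf) (wT := wT)
    (Pj := fun j _ co => TV.base.testR4 TV.MB (TV.AB j) co) hL hGR
  TV.k1bDR_of_checksVR' kitOf wT sc A B B'' hcoef hS hSN hk ⟨hnode0, hrB, fun j hj s hs => (hsteps j hj s hs).1⟩ hK hE hchk'
    (fun j hj s hs => (hsteps j hj s hs).2) (G := fun j => TV.GrC kitOf wT j L) (ΛT := TV.ΛTr)
    (hR0_all (sc := sc) hc0) (hR1_all (sc := sc) hc1)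
    (hR2_allC (sc := sc) hL hGR (TV.stageNumerics_of_checkV kitOf wT sc A B hcoef hSN))
    (hR3a_allC (sc := sc) hL hGR) (hR3b_allC (sc := sc) hL hGR hcL)

end CertTablesV

end Summit.NavierStokesRegularity.NavierStokesRegularity.Theorems.TaylorModelCert
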